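import Summits.ABC.IUTFork.Repair.CandJoshi1Real
import Summits.ABC.IUTFork.Cor312OrbitExcursionWitness
import HarnessLib

/-!
# IUT REPAIR branch (rung LADDER-ABC:A2.RP), rows RP-J01a/b/c + RP-J02a/b — PROFILE cells on the ORBIT-EXCURSION bed P♮ₑ
# (abc-iut-rp-h3's `Cor312Vol.ExcursionWitness.excSetting`): the typed Statement HOLDS there by isometric hull inflation, and EVERY
# Joshi-shaped candidate FAILS

PROOF-ONLY record file (D-0012; no definition, no `Prop` fact) of the abc-iut cell, IUT REPAIR branch, seat abc-iut-rp-j1 (gen 3); companion of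
`Repair/CandJoshi1Real` (the REAL column). TAKES NO SIDE on [IUTchIII] Cor. 3.12 and on no author (Mochizuki / Scholze–Stix / Joshi /
Dupuy–Hilado); candidates are hypotheses (reading predicates, never asserted); typed ≠ proved; instantiated ≠ endorsed; a toy bed is not IUT's data.

THE BED (cited by name, not restated): abc-iut-rp-h3's P♮ₑ = `excSetting` over `excFull` (`Cor312OrbitExcursionBoxes/Model/Thm311/Witness`):
honest graded split model on `(ℚ²)^{⊗(j+1)}`, (Ind1) = capsule permutations, fine graded polydisc frame; typed Thm. 3.11, `BridgeHyps`, the THREE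
pins (`excSetting_pinnedRegions3`), the whole honesty vector `exc_honesty_vector` (KummerB, Step (x) admissibility transport AND log-volume
invariance non-trivially, admissible (Ind3)-regions, `|log(q)| > 0`, exact `j²`, label-independent q) — and the printed Statement TRUE with
STRICT inequality `−|log(q)| = −1/2 < −3/8 = −|log(Θ)|` (`excSetting_statement_strict`) by ORBIT-HULL INFLATION, while `S`,
`PilotKummerCompat`, the (xi-f) Licence and `GapH3` are FALSE (`excSetting_not_licence`, …). It is the one bed of record where the Statement holds
on data keeping every clause of the ∀-countermodel.

THE CELLS (kernel, standard axioms; one theorem per row, then packaged — column «EXC» for abc-iut-rp-plan's PROFILE / §J table):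
**H_J1 ✗ · H_J2 ✗ · H_J2ᵖˡ ✗ · H_J3 ✗ · H_J3′ ✗** at P♮ₑ (`exc_not_joshiDominance`, `exc_not_joshiVolumeDominance`, `exc_not_placeDominance`,
`exc_not_locusCovers`, `exc_not_shellFilling`; package `exc_cells`). H_J1/H_J2/H_J2ᵖˡ/H_J3′ fall to this seat's honest-data forms
(`CandJoshi1Real.*_false_of_honestData`, fed with `exc_honesty_vector` BY NAME); H_J3 (UNION level) falls because under the q-pin it gives the
hull clause and hence the (xi-f) Licence (`CandJoshi3.hull_of_locusCovers`, `licence_of_pilotKummerCompatHull`), FALSE at P♮ₑ: the permuted deep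
boxes inflate the HULL enough for the AVERAGED inequality but neither their union nor their hull contains the q-polydisc.
READING for the census (neutral): the only mechanism of record by which the typed Statement holds on honest pinned data — isometric orbit
excursion, Dupuy–Hilado II §6.2 — is INVISIBLE to all five Joshi-shaped readings (single translate / packet volume / place volume / union /
filling): at P♮ₑ the profile of the J rows is that of FLIP and 2P(0,3), «Statement ✓, every Joshi candidate ✗». Together with `CandJoshi1Real`
(genuine data: ✗ as soon as the row's own pins are granted, H_J3 on `OrbitInside` or with an odd unramified bad prime) this closes the j1 PROFILE:
CM ✗⁵ · LS(d) per thresholds · P♭/P♮/uLinkId ✓✓✓✓✗ · uSetting ✗⁵ · SCAL ✓⁵ (priced) · 2P(0,3) ✗⁴ · EXC ✗⁵ · REAL ✗ (pinned/conditional as stated).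
[claim: Joshi2024ATSIII, status: disputed] [claim: Joshi2021ATSII, status: disputed] [cite: DupuyHilado2020, §6.2 pp. 19–20]
[cite: ScholzeStix2018, §2.2 pp. 9–10]
-/

noncomputable section

open Set

namespace Summit.ABC.IUTFork.Repair.CandJoshi1Exc

open Thm311 Cor312 Cor312Vol Literature.IUT.LogThetaLattice
open Cor312Vol.SplitWitness Cor312Vol.ExcursionWitness
open Summit.ABC.IUTFork.Repair.CandJoshi1 Summit.ABC.IUTFork.Repair.CandJoshi3 Summit.ABC.IUTFork.Repair.CandJoshi9
open Summit.ABC.IUTFork.Repair.CandJoshi1Real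

/-! ## 1. The frame-blind rows at P♮ₑ -/

/-- **EXC, RP-J01b: H_J2 FAILS at P♮ₑ** — the honesty vector feeds `CandJoshi1Real.joshiVolumeDominance_false_of_honestData`: with Step (x)
isometry and exact `j²`, no possible image (a permuted deep box, volume `4·qLocal` at label `2`) dominates the q-term. [folklore] -/
theorem exc_not_joshiVolumeDominance : ¬ JoshiVolumeDominance excSetting :=
  joshiVolumeDominance_false_of_honestData excSetting exc_honesty_vector.2.2.1 exc_honesty_vector.2.2.2.1 excSetting_bridgeHyps
    exc_honesty_vector.2.2.2.2.2.2.1 exc_honesty_vector.2.2.2.2.2.2.2 excSetting_absLogQPos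

/-- **EXC, RP-J01c: H_J2ᵖˡ (per place, label-summed) FAILS at P♮ₑ.** [folklore] -/
theorem exc_not_placeDominance : ¬ JoshiPlaceDominance excSetting :=
  placeDominance_false_of_honestData excSetting exc_honesty_vector.2.2.1 exc_honesty_vector.2.2.2.1 excSetting_bridgeHyps
    exc_honesty_vector.2.2.2.2.2.2.1 exc_honesty_vector.2.2.2.2.2.2.2 excSetting_absLogQPos

/-! ## 2. The pinned rows at P♮ₑ -/

/-- **EXC, RP-J01a: H_J1 FAILS at P♮ₑ** (the two pins hold there, so H_J1 ⟹ H_J2). [folklore] -/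
theorem exc_not_joshiDominance : ¬ JoshiDominance excFull.toLatticeSituation excSetting gradedRegion qDatumE :=
  joshiDominance_false_of_honestData excFull.toLatticeSituation excSetting gradedRegion qDatumE excSetting_pinnedRegions3.1
    exc_honesty_vector.2.2.1 exc_honesty_vector.2.2.2.1 excSetting_bridgeHyps exc_honesty_vector.2.2.2.2.2.2.1
    exc_honesty_vector.2.2.2.2.2.2.2 excSetting_absLogQPos

/-- **EXC, RP-J02a: H_J3 (the theta-values LOCUS covers the q-region) FAILS at P♮ₑ** — under the q-pin H_J3 gives the hull clause, hence the
(xi-f) Licence, which is FALSE at P♮ₑ (`excSetting_not_licence`): the (Ind1)-orbit inflates the hull's VOLUME (Statement ✓) without the union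
or the hull of the permuted deep boxes containing the q-polydisc. The orbit-excursion door of the Statement is shut for the union reading.
[cite: DupuyHilado2020, §6.2 pp. 19–20] -/
theorem exc_not_locusCovers : ¬ LocusCovers excFull.toLatticeSituation excSetting gradedRegion qDatumE := fun h =>
  excSetting_not_licence (licence_of_pilotKummerCompatHull excFull.toLatticeSituation excSetting gradedRegion qDatumE excSetting_qPinned
    (hull_of_locusCovers excFull.toLatticeSituation excSetting gradedRegion qDatumE h))

/-- RF-J1 at P♮ₑ on `𝔽_l^⋇`: the q-region `gbox (lastDepth j 1)` lies in the data-(a) log-shell, the unit box `gbox 0`. [folklore] -/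
theorem exc_rfJ1 (i : Fin splitIndex.lstar) (vQ : splitIndex.VQ) :
    excSetting.qRegion (Setting.labelSucc i) vQ ⊆ (excFull.toLatticeSituation.D excSetting.n).shellPk (Setting.labelSucc i) vQ := by
  rw [(excSetting_regions_of_ne_zero (Setting.labelSucc_ne_zero i) vQ).2]
  show gbox (lastDepth _ 1) ⊆ (gbox 0 : Set (splitShells.Packet (Setting.labelSucc i) vQ))
  exact gbox_antitone fun _ => Nat.zero_le _

/-- RF-J2 at P♮ₑ on `𝔽_l^⋇`: every Θ-Kummer-image `gbox (lastDepth j j²)` lies in the q-region `gbox (lastDepth j 1)` (`1 ≤ j²`). [folklore] -/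
theorem exc_rfJ2 (i : Fin splitIndex.lstar) (vQ : splitIndex.VQ) :
    ∃ m : ℤ, excSetting.thetaRegion m (Setting.labelSucc i) vQ ⊆ excSetting.qRegion (Setting.labelSucc i) vQ := by
  refine ⟨0, ?_⟩
  rw [excSetting_thetaRegion, thetaGlue_one_of_ne_zero (Setting.labelSucc_ne_zero i),
    (excSetting_regions_of_ne_zero (Setting.labelSucc_ne_zero i) vQ).2]
  refine gbox_antitone fun c => ?_
  unfold lastDepth
  split_ifs
  · exact Nat.one_le_pow _ _ (Nat.pos_of_ne_zero fun h => Setting.labelSucc_ne_zero i (Fin.ext h))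
  · exact le_rfl

/-- **EXC, RP-J02b: H_J3′ (the Θ-side FILLING) FAILS at P♮ₑ** — the Θ-pin and both repair facts hold there (RF-J1 `exc_rfJ1`, RF-J2 `exc_rfJ2`), so
H_J3′ would give READING R3 and H_J2 (`CandJoshi1Real.shellFilling_false_of_honestData`). [folklore] -/
theorem exc_not_shellFilling : ¬ ShellFilling excFull.toLatticeSituation excSetting gradedRegion :=
  shellFilling_false_of_honestData excFull.toLatticeSituation excSetting gradedRegion excSetting_pinnedRegions3.1.1 exc_rfJ1 exc_rfJ2
    exc_honesty_vector.2.2.1 exc_honesty_vector.2.2.2.1 excSetting_bridgeHyps exc_honesty_vector.2.2.2.2.2.2.1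
    exc_honesty_vector.2.2.2.2.2.2.2 excSetting_absLogQPos

/-! ## 3. The column, packaged -/

/-- **EXC cells, packaged**: at P♮ₑ — three pins ∧ BridgeHyps ∧ `|log(q)| > 0` ∧ the printed Statement STRICT — **all five Joshi-shaped
candidates FAIL**, together with `S`, the (xi-f) Licence and `GapH3`. The Statement's orbit-excursion mechanism is invisible to the Joshi readings.
[folklore] -/
theorem exc_cells :
    PinnedRegions3 excFull.toLatticeSituation excSetting gradedRegion qDatumE ∧ BridgeHyps excSetting ∧ excSetting.AbsLogQPos ∧
      excSetting.Statement ∧ ((excSetting.negLogQ : ℝ) : WithTop ℝ) < excSetting.negLogTheta ∧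
      ¬ JoshiDominance excFull.toLatticeSituation excSetting gradedRegion qDatumE ∧ ¬ JoshiVolumeDominance excSetting ∧
      ¬ JoshiPlaceDominance excSetting ∧ ¬ LocusCovers excFull.toLatticeSituation excSetting gradedRegion qDatumE ∧
      ¬ ShellFilling excFull.toLatticeSituation excSetting gradedRegion ∧
      ¬ PilotKummerIndRelated excFull.toLatticeSituation excSetting gradedRegion qDatumE ∧ ¬ Thm311ToCor312.Licence excSetting ∧
      ¬ GapH3 excFull.toLatticeSituation excSetting gradedRegion qDatumE :=
  ⟨excSetting_pinnedRegions3, excSetting_bridgeHyps, excSetting_absLogQPos, excSetting_statement_strict.1, excSetting_statement_strict.2,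
    exc_not_joshiDominance, exc_not_joshiVolumeDominance, exc_not_placeDominance, exc_not_locusCovers, exc_not_shellFilling,
    excSetting_not_pilotKummerIndRelated, excSetting_not_licence, excSetting_not_gapH3⟩

/-- **The J rows share the FLIP / 2P profile at P♮ₑ: Statement ✓ while every SUFFICIENT Joshi candidate ✗** — so none of them is NECESSARY for
the typed Statement on honest pinned data either (strictness of «H ⟹ Statement» witnessed on a bed keeping Step (x) and exact `j²`, not only on
the frame flip). [folklore] -/
theorem exc_statement_without_joshi :
    excSetting.Statement ∧ ¬ JoshiDominance excFull.toLatticeSituation excSetting gradedRegion qDatumE ∧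
      ¬ JoshiVolumeDominance excSetting ∧ ¬ JoshiPlaceDominance excSetting ∧
      ¬ LocusCovers excFull.toLatticeSituation excSetting gradedRegion qDatumE :=
  ⟨excSetting_statement_strict.1, exc_not_joshiDominance, exc_not_joshiVolumeDominance, exc_not_placeDominance, exc_not_locusCovers⟩

end Summit.ABC.IUTFork.Repair.CandJoshi1Exc

end
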